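import Mathlib
import HarnessLib

/-!
# The lattice of degrees of homogeneous sections not vanishing at a point

Topic: `Summits/ResolutionOfSingularities/ResolutionOfSingularities/Theorems`. Helper file of the
stub `stub_quotientSingularities_of_regular` of the line `Sketch` of the crux
`Theses.WeightedInvariant.DatumToEmbedded` (statement `stmt-ResolutionOfSingularities-0572`).

Let `R = ⨁_χ R_χ` be a commutative algebra graded by an abelian group `G` (the character group
of a diagonalizable group acting on `Spec R`) and suppose that for some `e ≥ 1` every degree
`e • χ` carries a homogeneous UNIT (finite stabilisers: Włodarczyk, arXiv:2203.03090, §2.3.1).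
For a prime `P` of `R` the degrees `χ` carrying a homogeneous element NOT in `P`
form a subgroup `M_P ≤ G` (`degLattice`; a submonoid for any grading, a group because
`-χ = (e-1)•χ + e•(-χ)`), containing `e • G` (`nsmul_mem_degLattice`), hence of finite index
when `G` is finitely generated (`finite_quotient_degLattice`) — geometrically `M_P` is the
character group of the quotient of the torus by the stabiliser of the orbit through `P`, and
`G ⧸ M_P` is the (finite) character group of the stabiliser. Primes with the same degree-`0`
part (= the same image in the quotient `Spec R₀`) have the same lattice
(`degLattice_eq_of_forall_mem_zero_iff`: all orbits are closed), so every homogeneous element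
whose degree is not in `M_P` lies in every prime over the image of `P`
(`mem_of_not_mem_degLattice`).

Only Mathlib is used.
-/

-- the summit namespace repeats `ResolutionOfSingularities` by design (mandated namespace)
set_option linter.dupNamespace false

namespace Summit.ResolutionOfSingularities.ResolutionOfSingularities.Theorems.DatumToEmbedded.QuotientSingularities

section Lattice

variable {k R G : Type*} [CommRing k] [CommRing R] [Algebra k R] [AddCommGroup G] [DecidableEq G]
  (𝓡 : G → Submodule k R) [GradedAlgebra 𝓡] {e : ℕ} (he : 0 < e)
  (hunit : ∀ χ : G, ∃ u ∈ 𝓡 (e • χ), IsUnit u)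

include he hunit in
omit [DecidableEq G] in
/-- With homogeneous units in all degrees `e • χ` (`e ≥ 1`), a homogeneous element of degree `χ`
outside a prime `P` yields one of degree `-χ` outside `P`: `r ^ (e - 1) · u` with `u` a unit of
degree `e • (-χ)`. [folklore] -/
theorem exists_mem_neg_notMem [SetLike.GradedMonoid 𝓡] (P : Ideal R) [P.IsPrime] {χ : G} {r : R}
    (hr : r ∈ 𝓡 χ) (hrP : r ∉ P) : ∃ s ∈ 𝓡 (-χ), s ∉ P := by
  obtain ⟨e', rfl⟩ : ∃ e', e = e' + 1 := ⟨e - 1, (Nat.sub_add_cancel he).symm⟩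
  obtain ⟨u, hu, huu⟩ := hunit (-χ)
  have hdeg : e' • χ + (e' + 1) • (-χ) = -χ := by
    rw [succ_nsmul, smul_neg]
    abel
  refine ⟨r ^ e' * u, hdeg ▸ SetLike.mul_mem_graded (SetLike.pow_mem_graded e' hr) hu, fun h => ?_⟩
  rcases Ideal.IsPrime.mem_or_mem ‹P.IsPrime› h with h | h
  · exact hrP (Ideal.IsPrime.mem_of_pow_mem ‹P.IsPrime› e' h)
  · exact Ideal.IsPrime.ne_top ‹P.IsPrime› (Ideal.eq_top_of_isUnit_mem _ h huu)

/-- The lattice of degrees at `P` as an additive subgroup: the degrees `χ` carrying a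
homogeneous element not in the prime `P` — a subgroup of the group of degrees thanks to the
units of degrees `e • χ`. [folklore] -/
def degLatticeAddSubgroup (P : Ideal R) [P.IsPrime] : AddSubgroup G where
  carrier := {χ | ∃ r ∈ 𝓡 χ, r ∉ P}
  zero_mem' := ⟨1, SetLike.one_mem_graded 𝓡,
    (Ideal.ne_top_iff_one P).1 (Ideal.IsPrime.ne_top ‹P.IsPrime›)⟩
  add_mem' := by
    rintro χ ψ ⟨r, hr, hrP⟩ ⟨s, hs, hsP⟩
    exact ⟨r * s, SetLike.mul_mem_graded hr hs,
      fun h => (Ideal.IsPrime.mem_or_mem ‹P.IsPrime› h).elim hrP hsP⟩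
  neg_mem' := by
    rintro χ ⟨r, hr, hrP⟩
    exact exists_mem_neg_notMem 𝓡 he hunit P hr hrP

/-- The **lattice of degrees at `P`** (as a `ℤ`-submodule of the group of degrees): the degrees
`χ` carrying a homogeneous element not in the prime `P`. [folklore] -/
def degLattice (P : Ideal R) [P.IsPrime] : Submodule ℤ G :=
  AddSubgroup.toIntSubmodule (degLatticeAddSubgroup 𝓡 he hunit P)

variable (P : Ideal R) [P.IsPrime]

variable {𝓡 P} in
/-- Membership in the lattice of degrees at `P`. [folklore] -/
theorem mem_degLattice_iff {χ : G} : χ ∈ degLattice 𝓡 he hunit P ↔ ∃ r ∈ 𝓡 χ, r ∉ P :=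
  Iff.rfl

/-- The lattice of degrees at `P` contains `e • G` (the units). [folklore] -/
theorem nsmul_mem_degLattice (χ : G) : e • χ ∈ degLattice 𝓡 he hunit P := by
  obtain ⟨u, hu, huu⟩ := hunit χ
  exact ⟨u, hu, fun h => Ideal.IsPrime.ne_top ‹P.IsPrime› (Ideal.eq_top_of_isUnit_mem _ h huu)⟩

/-- For a finitely generated group of degrees the lattice of degrees at `P` has **finite index**:
the quotient is finitely generated and killed by `e`. [folklore] -/
theorem finite_quotient_degLattice [AddGroup.FG G] : Finite (G ⧸ degLattice 𝓡 he hunit P) := by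
  change Finite (G ⧸ degLatticeAddSubgroup 𝓡 he hunit P)
  refine AddCommGroup.finite_of_fg_torsion _ fun x => ?_
  obtain ⟨χ, rfl⟩ := QuotientAddGroup.mk_surjective x
  refine (isOfFinAddOrder_iff_nsmul_eq_zero).2 ⟨e, he, ?_⟩
  rw [← QuotientAddGroup.mk_nsmul, QuotientAddGroup.eq_zero_iff]
  exact nsmul_mem_degLattice 𝓡 he hunit P χ

/-- **Primes with the same degree-`0` part have the same lattice of degrees** (closed orbits):
if `χ ∈ M_Q`, pick homogeneous `r ∉ Q` of degree `χ` and `s ∉ Q` of degree `-χ`; then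
`r s ∈ R₀ ∖ Q = R₀ ∖ P`, so `r ∉ P` and `χ ∈ M_P`. [folklore] -/
theorem degLattice_le_of_forall_mem_zero_iff (Q : Ideal R) [Q.IsPrime]
    (hPQ : ∀ r ∈ 𝓡 0, r ∈ Q ↔ r ∈ P) :
    degLattice 𝓡 he hunit Q ≤ degLattice 𝓡 he hunit P := by
  rintro χ ⟨r, hr, hrQ⟩
  obtain ⟨s, hs, hsQ⟩ := exists_mem_neg_notMem 𝓡 he hunit Q hr hrQ
  have hrs : r * s ∈ 𝓡 0 := by simpa using SetLike.mul_mem_graded hr hs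
  have hrsQ : r * s ∉ Q := fun h => (Ideal.IsPrime.mem_or_mem ‹Q.IsPrime› h).elim hrQ hsQ
  have hrsP : r * s ∉ P := fun h => hrsQ ((hPQ _ hrs).2 h)
  exact ⟨r, hr, fun h => hrsP (P.mul_mem_right s h)⟩

/-- Primes with the same degree-`0` part have the same lattice of degrees. [folklore] -/
theorem degLattice_eq_of_forall_mem_zero_iff (Q : Ideal R) [Q.IsPrime]
    (hPQ : ∀ r ∈ 𝓡 0, r ∈ Q ↔ r ∈ P) :
    degLattice 𝓡 he hunit Q = degLattice 𝓡 he hunit P :=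
  le_antisymm (degLattice_le_of_forall_mem_zero_iff 𝓡 he hunit P Q hPQ)
    (degLattice_le_of_forall_mem_zero_iff 𝓡 he hunit Q P fun r hr => (hPQ r hr).symm)

/-- **Homogeneous elements of degree outside `M_P` vanish along the whole fibre of the quotient
map through `P`**: they lie in every prime `Q` with `Q ∩ R₀ = P ∩ R₀`. [folklore] -/
theorem mem_of_not_mem_degLattice (Q : Ideal R) [Q.IsPrime]
    (hPQ : ∀ r ∈ 𝓡 0, r ∈ Q ↔ r ∈ P) {χ : G} (hχ : χ ∉ degLattice 𝓡 he hunit P) {r : R}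
    (hr : r ∈ 𝓡 χ) : r ∈ Q := by
  by_contra hrQ
  rw [← degLattice_eq_of_forall_mem_zero_iff 𝓡 he hunit P Q hPQ] at hχ
  exact hχ ⟨r, hr, hrQ⟩

end Lattice

end Summit.ResolutionOfSingularities.ResolutionOfSingularities.Theorems.DatumToEmbedded.QuotientSingularities
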